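import Literature.NumberTheory.Transcendental.KZProductIdeal
import Literature.NumberTheory.Transcendental.KZCalculusProofs
import Literature.NumberTheory.Transcendental.KZMellinFibres
import Literature.NumberTheory.Transcendental.KZSemiCanonicalReductionProofs
import Literature.NumberTheory.Transcendental.BoxIntegralLTwoChiThree
import HarnessLib

/-!
# The LEGENDRE AUTOPSY for `QuadraticDescent` (stmt-KontsevichZagierPeriods-26540) — part 1/3: the data (`Q_c`, `K c`, `E c`, the PRINTED hypothesis `LegendreRelation c`), the one-dimensional representations `P` (π), `Ph` (π/2), `BK c`, `BE c` and their values

Theorems-split (≤ 400 lines each) of the decomp-kz lens-6 gen-4 file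
`run/shared/lean/pub/decomp-kz/decomp-kz-lens-6/g4/RootDecompQuadraticDescentLegendre.lean` (778 lines; critic CONFIRMED
2026-08-30T04:24:12Z: rc0 / 0 warn / std axioms, axioms(legendre_improper) = {propext, Classical.choice, Quot.sound}); parts
`…LegendreData` → `…LegendrePairs` → `…Legendre`. `LegendreRelation c` (K·E′ + E·K′ − K·K′ = π/2 for y² = t⁴ ± ct² + 1, |c| < 2)
is a PRINTED HYPOTHESIS, not proved here. Support (T5 evidence) for 26540; the named residue `LegendreByMoves` is an
instrument target of 26541 / 24769. Sources: Legendre 1825; Whittaker–Watson §22.736; Kontsevich–Zagier 2001 §1.2, §2.2.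
-/

noncomputable section

set_option linter.dupNamespace false

open MeasureTheory Set
open MvPolynomial (aeval X C)
open Literature.ModelTheory.ExponentialFields (IsSemialgebraic tarski_seidenberg_real_holds)

namespace Summit.KontsevichZagierPeriods.KontsevichZagierPeriods.Theorems.RootDecompQuadraticDescentLegendre

open Literature.NumberTheory.Transcendental
open Literature.NumberTheory.Transcendental.KZ

section LegendreAutopsy

/-! ### The data: the quartic `Q_c`, the elliptic integrals `K c`, `E c`, Legendre's relation -/

/-- The even quartic `Q_c(t) = t⁴ + c t² + 1` (positive on `ℝ` for `|c| < 2`; `y² = Q_c(t)` is an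
elliptic curve for `c ≠ ±2`). -/
def Qr (c : ℚ) (t : ℝ) : ℝ := t ^ 4 + (c : ℝ) * t ^ 2 + 1

/-- Auxiliary step `Qr_pos`. [bookkeeping] -/
lemma Qr_pos {c : ℚ} (hc : -2 < c) (hc' : c < 2) (t : ℝ) : 0 < Qr c t := by
  have h1 : (-2 : ℝ) < c := by exact_mod_cast hc
  have h2 : (c : ℝ) < 2 := by exact_mod_cast hc'
  unfold Qr
  nlinarith [sq_nonneg (t ^ 2 + c / 2), mul_pos (sub_pos.2 h2) (by linarith : (0:ℝ) < c + 2)]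

/-- `K c := ∫₀¹ 2 dt / √Q_c(t)` — a period of the first kind of `y² = Q_c(t)` (for `c = -(1+k²)…`
a complete elliptic integral of the first kind up to an algebraic factor). -/
def K (c : ℚ) : ℝ := ∫ t in Set.Ioo (0:ℝ) 1, 2 / Real.sqrt (Qr c t)

/-- `E c := ∫₀¹ 2 √Q_c(t) dt / (1+t²)²` — a period of the second kind of `y² = Q_c(t)`. -/
def E (c : ℚ) : ℝ := ∫ t in Set.Ioo (0:ℝ) 1, 2 * Real.sqrt (Qr c t) / (1 + t ^ 2) ^ 2

/-- LEGENDRE'S RELATION for the pair of curves `y² = Q_c`, `y² = Q_{-c}` in the normalisation of this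
file (PRINTED: Legendre 1825; e.g. [Whittaker–Watson §22.736], [KZ 2001 §2.2 "periods of the second
kind"]; numerically `K(1)E(-1)+E(1)K(-1)-K(1)K(-1) = 1.5707963…`): the hypothesis under which the
Legendre test element has value `0`.  It is NOT proved here (it is the transcendental INPUT whose
descent is being located). -/
def LegendreRelation (c : ℚ) : Prop :=
  K c * E (-c) + E c * K (-c) - K c * K (-c) = Real.pi / 2

/-! ### One-dimensional representations: `(0,1) ⊂ ℝ¹`, transport, the rational `P`, `Ph` and the
algebraic `BK`, `BE` -/

/-- The open unit interval as a subset of `ℝ¹`. -/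
def I1 : Set (Fin 1 → ℝ) := {t | t 0 ∈ Set.Ioo (0:ℝ) 1}

/-- `I1` is `ℚ`-semialgebraic. [BCR1998 §2.2] -/
lemma isSemialgebraic_I1 : IsSemialgebraic ℚ I1 := by
  convert KZ.isSemialgebraic_box 1 using 1
  ext x
  simp [I1, Fin.forall_fin_one]

/-- `I1` is measurable. [bookkeeping] -/
lemma measurableSet_I1 : MeasurableSet I1 :=
  measurableSet_Ioo.preimage (measurable_pi_apply 0)

/-- Integrability on the relevant piece (`integrableOn_I1_of`). [bookkeeping] -/
lemma integrableOn_I1_of {f : ℝ → ℝ} (hf : IntegrableOn f (Set.Ioo (0:ℝ) 1)) :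
    IntegrableOn (fun t : Fin 1 → ℝ => f (t 0)) I1 :=
  ((volume_preserving_funUnique (Fin 1) ℝ).integrableOn_comp_preimage
      (MeasurableEquiv.funUnique (Fin 1) ℝ).measurableEmbedding).2 hf

/-- Set integral over `I1` rewritten in one variable. [bookkeeping] -/
lemma setIntegral_I1 (f : ℝ → ℝ) :
    ∫ t in I1, f (t 0) = ∫ x in Set.Ioo (0:ℝ) 1, f x :=
  (volume_preserving_funUnique (Fin 1) ℝ).setIntegral_preimage_emb
    (MeasurableEquiv.funUnique (Fin 1) ℝ).measurableEmbedding f (Set.Ioo (0:ℝ) 1)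

/-- Integrability on the relevant piece (`integrableOn_Ioo_of_continuous`). [bookkeeping] -/
lemma integrableOn_Ioo_of_continuous {f : ℝ → ℝ} (hf : Continuous f) :
    IntegrableOn f (Set.Ioo (0:ℝ) 1) :=
  (hf.integrableOn_Icc (a := 0) (b := 1)).mono_set Set.Ioo_subset_Icc_self

/-- `P := [(0,1), 4/(1+u²)]` — KZ-rational, dimension `1`, value `π`. -/
def P : KZ.IntegralRep 1 :=
  KZ.IntegralRep.ofRational I1 (C 4) (1 + X 0 ^ 2) isSemialgebraic_I1
    (fun x _ => by simp; positivity)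
    (by
      have hc4 : Continuous (fun u : ℝ => 4 / (1 + u ^ 2)) :=
        Continuous.div continuous_const (by fun_prop) fun u => by positivity
      have h : IntegrableOn (fun t : Fin 1 → ℝ => (fun u : ℝ => 4 / (1 + u ^ 2)) (t 0)) I1 :=
        integrableOn_I1_of (f := fun u : ℝ => 4 / (1 + u ^ 2)) (integrableOn_Ioo_of_continuous hc4)
      refine h.congr_fun (fun t _ => ?_) measurableSet_I1
      simp)

/-- `Ph := [(0,1), 2/(1+u²)]` — KZ-rational, dimension `1`, value `π/2`. -/
def Ph : KZ.IntegralRep 1 :=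
  KZ.IntegralRep.ofRational I1 (C 2) (1 + X 0 ^ 2) isSemialgebraic_I1
    (fun x _ => by simp; positivity)
    (by
      have hc2 : Continuous (fun u : ℝ => 2 / (1 + u ^ 2)) :=
        Continuous.div continuous_const (by fun_prop) fun u => by positivity
      have h : IntegrableOn (fun t : Fin 1 → ℝ => (fun u : ℝ => 2 / (1 + u ^ 2)) (t 0)) I1 :=
        integrableOn_I1_of (f := fun u : ℝ => 2 / (1 + u ^ 2)) (integrableOn_Ioo_of_continuous hc2)
      refine h.congr_fun (fun t _ => ?_) measurableSet_I1
      simp)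

/-- `P` is KZ-rational. [bookkeeping] -/
lemma isRational_P : P.IsRational := KZ.IntegralRep.isRational_ofRational _ _ _ _ _ _
/-- `Ph` is KZ-rational. [bookkeeping] -/
lemma isRational_Ph : Ph.IsRational := KZ.IntegralRep.isRational_ofRational _ _ _ _ _ _
/-- The domain of `P`, by definition. [bookkeeping] -/
lemma domain_P : P.domain = I1 := rfl
/-- The domain of `Ph`, by definition. [bookkeeping] -/
lemma domain_Ph : Ph.domain = I1 := rfl

/-- The value of `P`. [bookkeeping] -/
lemma value_P : P.value = Real.pi := by
  have integral_four_div : ∫ x in Set.Ioo (0:ℝ) 1, 4 / (1 + x ^ 2) = Real.pi := by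
    rw [← integral_Ioc_eq_integral_Ioo, ← intervalIntegral.integral_of_le zero_le_one]
    have h := integral_inv_one_add_sq (a := (0:ℝ)) (b := 1)
    have e : (fun x : ℝ => 4 / (1 + x ^ 2)) = fun x => 4 * (1 + x ^ 2)⁻¹ := by
      funext x; rw [div_eq_mul_inv]
    rw [e, intervalIntegral.integral_const_mul, h, Real.arctan_one, Real.arctan_zero]
    ring
  rw [P, KZ.IntegralRep.value_ofRational, ← integral_four_div, ← setIntegral_I1]
  refine setIntegral_congr_fun measurableSet_I1 fun t _ => ?_
  simp

/-- The value of `Ph`. [bookkeeping] -/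
lemma value_Ph : Ph.value = Real.pi / 2 := by
  have integral_four_div : ∫ x in Set.Ioo (0:ℝ) 1, 4 / (1 + x ^ 2) = Real.pi := by
    rw [← integral_Ioc_eq_integral_Ioo, ← intervalIntegral.integral_of_le zero_le_one]
    have h := integral_inv_one_add_sq (a := (0:ℝ)) (b := 1)
    have e : (fun x : ℝ => 4 / (1 + x ^ 2)) = fun x => 4 * (1 + x ^ 2)⁻¹ := by
      funext x; rw [div_eq_mul_inv]
    rw [e, intervalIntegral.integral_const_mul, h, Real.arctan_one, Real.arctan_zero]
    ring
  rw [Ph, KZ.IntegralRep.value_ofRational]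
  have h2 : ∫ x in Set.Ioo (0:ℝ) 1, 2 / (1 + x ^ 2) = Real.pi / 2 := by
    have e : (fun x : ℝ => 2 / (1 + x ^ 2)) = fun x => (1/2 : ℝ) * (4 / (1 + x ^ 2)) := by
      funext x; ring
    rw [e, integral_const_mul, integral_four_div]; ring
  rw [← h2, ← setIntegral_I1]
  refine setIntegral_congr_fun measurableSet_I1 fun t _ => ?_
  simp

/-- The polynomial `Q_c(X₀)` in `m` variables. -/
def Qpoly (m : ℕ) (c : ℚ) : MvPolynomial (Fin (m + 1)) ℚ := X 0 ^ 4 + C c * X 0 ^ 2 + 1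

/-- Auxiliary step `aeval_Qpoly`. [bookkeeping] -/
@[simp] lemma aeval_Qpoly (m : ℕ) (c : ℚ) (x : Fin (m + 1) → ℝ) :
    aeval x (Qpoly m c) = Qr c (x 0) := by
  simp [Qpoly, Qr, map_add, map_mul, map_pow]

variable {c : ℚ}

/-- `BK c := [(0,1), 2/√Q_c(t)]` — dimension `1`, ALGEBRAIC integrand, value `K c`. -/
def BK (c : ℚ) (hc : -2 < c) (hc' : c < 2) : KZ.IntegralRep 1 where
  domain := I1
  integrand t := 2 / Real.sqrt (Qr c (t 0))
  isSemialgebraic_domain := isSemialgebraic_I1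
  isSemialgebraicFunOn_integrand := by
    refine (isSemialgebraicFunOn_mellinIntegrand isSemialgebraic_I1 ![Qpoly 0 c] ![(-1/2 : ℚ)] 2
      (fun x _ k => ?_)).congr fun x _ => ?_
    · fin_cases k
      simpa using Qr_pos hc hc' (x 0)
    · have hQ := Qr_pos hc hc' (x 0)
      simp only [mellinIntegrand_apply, Fin.prod_univ_one, Matrix.cons_val_fin_one, aeval_Qpoly]
      rw [show (((-1 / 2 : ℚ)) : ℝ) = -(1 / 2 : ℝ) by norm_num, Real.rpow_neg hQ.le, ← Real.sqrt_eq_rpow]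
      push_cast
      ring
  integrableOn := integrableOn_I1_of (f := fun u => 2 / Real.sqrt (Qr c u))
    (integrableOn_Ioo_of_continuous (Continuous.div continuous_const
      ((by unfold Qr; fun_prop : Continuous (Qr c)).sqrt) fun u => (Real.sqrt_pos.2 (Qr_pos hc hc' u)).ne'))

/-- `BE c := [(0,1), 2√Q_c(t)/(1+t²)²]` — dimension `1`, ALGEBRAIC integrand, value `E c`. -/
def BE (c : ℚ) (hc : -2 < c) (hc' : c < 2) : KZ.IntegralRep 1 where
  domain := I1
  integrand t := 2 * Real.sqrt (Qr c (t 0)) / (1 + (t 0) ^ 2) ^ 2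
  isSemialgebraic_domain := isSemialgebraic_I1
  isSemialgebraicFunOn_integrand := by
    refine (isSemialgebraicFunOn_mellinIntegrand isSemialgebraic_I1 ![Qpoly 0 c, 1 + X 0 ^ 2]
      ![(1/2 : ℚ), -2] 2 (fun x _ k => ?_)).congr fun x _ => ?_
    · fin_cases k
      · simpa using Qr_pos hc hc' (x 0)
      · simp; positivity
    · have hQ := Qr_pos hc hc' (x 0)
      have h1 : (0:ℝ) < 1 + (x 0) ^ 2 := by positivity
      simp only [mellinIntegrand_apply, Fin.prod_univ_two, Matrix.cons_val_zero, Matrix.cons_val_one,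
        Matrix.cons_val_fin_one, aeval_Qpoly, map_add, map_one, map_pow, MvPolynomial.aeval_X]
      rw [show (((1 / 2 : ℚ)) : ℝ) = (1 / 2 : ℝ) by norm_num, ← Real.sqrt_eq_rpow,
        show ((-2 : ℚ) : ℝ) = -(2 : ℝ) by norm_num, Real.rpow_neg h1.le, Real.rpow_two]
      push_cast
      field_simp
  integrableOn := integrableOn_I1_of (f := fun u => 2 * Real.sqrt (Qr c u) / (1 + u ^ 2) ^ 2)
    (integrableOn_Ioo_of_continuous (Continuous.div
      (continuous_const.mul ((by unfold Qr; fun_prop : Continuous (Qr c)).sqrt)) (by fun_prop)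
      fun u => by positivity))

/-- The value of `BK`. [bookkeeping] -/
lemma value_BK (hc : -2 < c) (hc' : c < 2) : (BK c hc hc').value = K c := by
  rw [KZ.IntegralRep.value, K]
  exact setIntegral_I1 (fun u => 2 / Real.sqrt (Qr c u))

/-- The value of `BE`. [bookkeeping] -/
lemma value_BE (hc : -2 < c) (hc' : c < 2) : (BE c hc hc').value = E c := by
  rw [KZ.IntegralRep.value, E]
  exact setIntegral_I1 (fun u => 2 * Real.sqrt (Qr c u) / (1 + u ^ 2) ^ 2)

/-- The domain of `BK`, by definition. [bookkeeping] -/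
lemma domain_BK (hc : -2 < c) (hc' : c < 2) : (BK c hc hc').domain = I1 := rfl
/-- The domain of `BE`, by definition. [bookkeeping] -/
lemma domain_BE (hc : -2 < c) (hc' : c < 2) : (BE c hc hc').domain = I1 := rfl

end LegendreAutopsy

end Summit.KontsevichZagierPeriods.KontsevichZagierPeriods.Theorems.RootDecompQuadraticDescentLegendre
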